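import Summits.AtomisticToContinuum.Crystallization.Theorems.SquareWellLayerCakeStackingFaultSparsityOffBoxDefs

/-!
# `StackingFaultSparsity` (stmt-AtomisticToContinuum-14296), line `Sketch`: soundness of the interval
checker, part B — the segment test and `obCheck` (stub `stub_offBoxGrid`, lead)

`obSegOK A B u₁ u₂ = true` implies `-717/1000 ≤ g(u) = (u²/12) A - (u/6) B` for every real `u ∈ [u₁, u₂]`
(vertex form of a convex quadratic; monotonicity to an end point; concavity), and the admissibility of
`(a, c)` on a grid interval puts `u = (a⁶)⁻¹` in the checker's `u`-range.  The soundness of `obCheck`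
itself (which also needs part A) is in `…OffBoxGridOf.lean`.  All `[folklore]`.
-/

noncomputable section

namespace Summit.AtomisticToContinuum.Crystallization.Theorems.SquareWellLayerCake.StackingFaultSparsity

open Summit.AtomisticToContinuum.Crystallization.Theorems.ExcessDecayLiouvilleCoarseGrains
open Finset

/-! ## The segment test -/

/-- The rational quadratic `obG` casts to the real one (the registered sub-goal carrying this file).
[folklore] -/
theorem cast_obG : ∀ (A B u : ℚ), ((obG A B u : ℚ) : ℝ) = (u : ℝ) ^ 2 / 12 * A - (u : ℝ) / 6 * B := by
  intro A B u; unfold obG; push_cast; ring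

/-- **Soundness of the segment test**: `obSegOK A B u₁ u₂ = true` gives `-717/1000 ≤ (u²/12) A - (u/6) B`
for every real `u ∈ [u₁, u₂]`. [folklore] -/
theorem obSegOK_sound {A B u₁ u₂ : ℚ} (h : obSegOK A B u₁ u₂ = true) {u : ℝ} (hu₁ : (u₁ : ℝ) ≤ u)
    (hu₂ : u ≤ (u₂ : ℝ)) : -(717 / 1000 : ℝ) ≤ u ^ 2 / 12 * (A : ℝ) - u / 6 * (B : ℝ) := by
  simp only [obSegOK, Bool.or_eq_true, Bool.and_eq_true, decide_eq_true_eq] at h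
  -- real versions of the rational facts
  have castG : ∀ v : ℚ, ((obG A B v : ℚ) : ℝ) = (v : ℝ) ^ 2 / 12 * A - (v : ℝ) / 6 * B := cast_obG A B
  rcases h with ((⟨hA, hB⟩ | ⟨⟨hg, hA⟩, hm⟩) | ⟨⟨hg, hA⟩, hm⟩) | ⟨⟨hA, hg₁⟩, hg₂⟩
  · -- vertex form: 12 A g(u) + 717·12 A/1000 = (uA - B)² - B² + 12 (717/1000) A ≥ 0
    have hA' : (0 : ℝ) < A := by exact_mod_cast hA
    have hB' : (B : ℝ) ^ 2 ≤ 12 * (717 / 1000) * A := by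
      have := (Rat.cast_le (K := ℝ)).2 hB
      push_cast at this
      exact this
    have key : 0 ≤ (u * (A : ℝ) - B) ^ 2 := sq_nonneg _
    have : 0 ≤ (A : ℝ) * (u ^ 2 / 12 * (A : ℝ) - u / 6 * (B : ℝ) + 717 / 1000) := by nlinarith
    have h2 := (mul_nonneg_iff_of_pos_left hA').1 this
    linarith
  · -- minimum at the right end point
    have hg' : -(717 / 1000 : ℝ) ≤ (u₂ : ℝ) ^ 2 / 12 * A - (u₂ : ℝ) / 6 * B := by
      have := (Rat.cast_le (K := ℝ)).2 hg
      rw [castG] at this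
      push_cast at this
      exact this
    have hA' : (0 : ℝ) ≤ A := by exact_mod_cast hA
    have hm' : (u₂ : ℝ) * A ≤ B := by exact_mod_cast hm
    have key : u ^ 2 / 12 * (A : ℝ) - u / 6 * (B : ℝ) - ((u₂ : ℝ) ^ 2 / 12 * A - (u₂ : ℝ) / 6 * B) =
        ((u₂ : ℝ) - u) * ((B : ℝ) / 6 - (A : ℝ) / 12 * (u + u₂)) := by ring
    have h1 : 0 ≤ (u₂ : ℝ) - u := by linarith
    have h2 : 0 ≤ (B : ℝ) / 6 - (A : ℝ) / 12 * (u + u₂) := by nlinarith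
    nlinarith [mul_nonneg h1 h2]
  · -- minimum at the left end point
    have hg' : -(717 / 1000 : ℝ) ≤ (u₁ : ℝ) ^ 2 / 12 * A - (u₁ : ℝ) / 6 * B := by
      have := (Rat.cast_le (K := ℝ)).2 hg
      rw [castG] at this
      push_cast at this
      exact this
    have hA' : (0 : ℝ) ≤ A := by exact_mod_cast hA
    have hm' : (B : ℝ) ≤ (u₁ : ℝ) * A := by exact_mod_cast hm
    have key : u ^ 2 / 12 * (A : ℝ) - u / 6 * (B : ℝ) - ((u₁ : ℝ) ^ 2 / 12 * A - (u₁ : ℝ) / 6 * B) =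
        (u - (u₁ : ℝ)) * ((A : ℝ) / 12 * (u + u₁) - (B : ℝ) / 6) := by ring
    have h1 : 0 ≤ u - (u₁ : ℝ) := by linarith
    have h2 : 0 ≤ (A : ℝ) / 12 * (u + u₁) - (B : ℝ) / 6 := by nlinarith
    nlinarith [mul_nonneg h1 h2]
  · -- concave: above the chord
    have hg₁' : -(717 / 1000 : ℝ) ≤ (u₁ : ℝ) ^ 2 / 12 * A - (u₁ : ℝ) / 6 * B := by
      have := (Rat.cast_le (K := ℝ)).2 hg₁
      rw [castG] at this
      push_cast at this
      exact this
    have hg₂' : -(717 / 1000 : ℝ) ≤ (u₂ : ℝ) ^ 2 / 12 * A - (u₂ : ℝ) / 6 * B := by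
      have := (Rat.cast_le (K := ℝ)).2 hg₂
      rw [castG] at this
      push_cast at this
      exact this
    have hA' : (A : ℝ) ≤ 0 := by exact_mod_cast hA
    have key : (u ^ 2 / 12 * (A : ℝ) - u / 6 * (B : ℝ)) * ((u₂ : ℝ) - u₁) -
        ((u₁ : ℝ) ^ 2 / 12 * A - (u₁ : ℝ) / 6 * B) * ((u₂ : ℝ) - u) -
        ((u₂ : ℝ) ^ 2 / 12 * A - (u₂ : ℝ) / 6 * B) * (u - (u₁ : ℝ)) =
        -((A : ℝ) / 12) * ((u - u₁) * ((u₂ : ℝ) - u) * ((u₂ : ℝ) - u₁)) := by ring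
    have h1 : 0 ≤ u - (u₁ : ℝ) := by linarith
    have h2 : 0 ≤ (u₂ : ℝ) - u := by linarith
    have h12 : 0 ≤ (u - u₁) * ((u₂ : ℝ) - u) * ((u₂ : ℝ) - u₁) :=
      mul_nonneg (mul_nonneg h1 h2) (by linarith)
    rcases eq_or_lt_of_le (show (u₁ : ℝ) ≤ u₂ by linarith) with heq | hlt
    · have : u = u₁ := by linarith
      rw [this]; exact hg₁'
    · have hpos : 0 < (u₂ : ℝ) - u₁ := by linarith
      -- g(u)(u₂-u₁) ≥ T (u₂ - u) + T (u - u₁) = T (u₂ - u₁)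
      have : -(717 / 1000 : ℝ) * ((u₂ : ℝ) - u₁) ≤
          (u ^ 2 / 12 * (A : ℝ) - u / 6 * (B : ℝ)) * ((u₂ : ℝ) - u₁) := by nlinarith
      exact le_of_mul_le_mul_right this hpos

/-! ## The admissible `u`-range -/

/-- From the admissibility of `(a, c)` on a grid interval (`0 < p₁`): the bounds on `u = (a⁶)⁻¹`. [folklore] -/
theorem u_range {a c : ℝ} {p₁ p₂ : ℕ} (hp₁ : 0 < p₁) (h₁ : (p₁ : ℝ) / 10000 ≤ c)
    (h₂ : c ≤ (p₂ : ℝ) / 10000) (ha1 : 1 / 2 < a) (ha2 : a < 2) (hc1 : 1 / 2 < a * c)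
    (hc2 : a * c < 2) :
    ((max (1 / 64 : ℚ) (((p₁ : ℚ) / 20000) ^ 6) : ℚ) : ℝ) < (a ^ 6)⁻¹ ∧
      (a ^ 6)⁻¹ < ((min (64 : ℚ) (((p₂ : ℚ) / 5000) ^ 6) : ℚ) : ℝ) := by
  have ha : 0 < a := by linarith
  have hp₁r : (0 : ℝ) < p₁ := by exact_mod_cast hp₁
  have hc : 0 < c := lt_of_lt_of_le (by positivity) h₁
  have ha6 : 0 < a ^ 6 := by positivity
  have hp₂r : (0 : ℝ) < p₂ := by
    by_contra hle
    push Not at hle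
    have : (p₂ : ℝ) / 10000 ≤ 0 := div_nonpos_of_nonpos_of_nonneg hle (by norm_num)
    linarith
  have hac₁ := mul_le_mul_of_nonneg_left h₁ ha.le
  have hac₂ := mul_le_mul_of_nonneg_left h₂ ha.le
  push_cast
  refine ⟨max_lt ?_ ?_, lt_min ?_ ?_⟩
  · -- `a < 2 ⇒ 1/64 < (a⁶)⁻¹`
    rw [lt_inv_comm₀ (by norm_num) ha6]
    calc a ^ 6 < 2 ^ 6 := pow_lt_pow_left₀ ha2 ha.le (by norm_num)
      _ = (1 / 64 : ℝ)⁻¹ := by norm_num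
  · -- `a c < 2`, `c ≥ p₁/10⁴ ⇒ a < 2·10⁴/p₁`
    rw [lt_inv_comm₀ (by positivity) ha6]
    have hlt : a < 20000 / (p₁ : ℝ) := by
      rw [lt_div_iff₀ hp₁r]; nlinarith
    calc a ^ 6 < (20000 / (p₁ : ℝ)) ^ 6 := pow_lt_pow_left₀ hlt ha.le (by norm_num)
      _ = (((p₁ : ℝ) / 20000) ^ 6)⁻¹ := by rw [← inv_pow, inv_div]
  · -- `1/2 < a ⇒ (a⁶)⁻¹ < 64`
    rw [inv_lt_comm₀ ha6 (by norm_num)]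
    calc (64 : ℝ)⁻¹ = (1 / 2) ^ 6 := by norm_num
      _ < a ^ 6 := pow_lt_pow_left₀ ha1 (by norm_num) (by norm_num)
  · -- `1/2 < a c`, `c ≤ p₂/10⁴ ⇒ 5000/p₂ < a`
    rw [inv_lt_comm₀ ha6 (by positivity)]
    have hlt : 5000 / (p₂ : ℝ) < a := by
      rw [div_lt_iff₀ hp₂r]; nlinarith
    calc (((p₂ : ℝ) / 5000) ^ 6)⁻¹ = (5000 / (p₂ : ℝ)) ^ 6 := by rw [← inv_pow, inv_div]
      _ < a ^ 6 := pow_lt_pow_left₀ hlt (by positivity) (by norm_num)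

end Summit.AtomisticToContinuum.Crystallization.Theorems.SquareWellLayerCake.StackingFaultSparsity

end
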